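import Summits.SmoothPoincare4.SmoothPoincare4.Theorems.ConvexBisectionAcyclicBisectionExistsEOneCurveRadial
import Summits.SmoothPoincare4.SmoothPoincare4.Theorems.ConvexBisectionAcyclicBisectionExistsEOneCurveChartOrient
import Summits.SmoothPoincare4.SmoothPoincare4.Theorems.ConvexBisectionAcyclicBisectionExistsEOneCurveZeroCross
import Summits.SmoothPoincare4.SmoothPoincare4.Theorems.ConvexBisectionAcyclicBisectionExistsChainPairings
import Summits.SmoothPoincare4.SmoothPoincare4.Theorems.ConvexBisectionAcyclicBisectionExistsPicardLefschetzVariation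
import HarnessLib

/-!
# The `e_1`-curve: one clean passage, the pairing `±1` with `chainVec g 3`, the shadow `±e_1`
(wave 7, bricks H5-5/H5-6 = (R-E1CURVE), the last geometric input of node N3a `node_STcurve` of stub
`stub_STgeo` = NF4 N3, line `modp-braid-orbits`, crux `ConvexBisection.AcyclicBisectionExists`, item
stmt-SmoothPoincare4-10508; registered sub-goals `helper_eOne_passage` and **`helper_exists_eOneCurve`**
— the hypothesis of G6's `helper_node_STcurve_of_eOneCurve` VERBATIM, so that N3a holds for every genus)

With OUR chart `φ = eoChart hg` (round circles around `c₀`, explicit sheet `eoY`; six chart hypotheses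
`helper_eoChart`) and the sheet loop `L` over the radial zig-zag `eoPath g` (shadow `chainVec g 3`,
`helper_eOne_sheetLoop`), `stdSymp (shadow b) (chainVec g 3) = crossingNumber φ L`
(`crossingNumber_eq_stdSymp`, X7) for the core `b` of `φ`.

* §3–4 **one clean passage** (`helper_eOne_passage`): a page loop tracing `eoPath` with
  `y = s · halfSign · √` whose returning (`τ > 1/2`) sheet `−s √` is the chart sheet on the radial
  segment runs INWARD through the collar once, from height `−3/4` to `3/4` (the loop IS `φ (u⋆, r)`
  there), and is off the collar elsewhere (segment legs inside radius `R − κ`; out-going leg on the other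
  sheet, (E2); the rest by radius, (E1)) — `crossingNumber φ = 1` (`crossingNumber_single_passage`);
* §5 applied to `L` or to its reverse `L ∘ reflS` according to the sign of the chart sheet
  (`helper_eOne_radial_sign`): `crossingNumber φ L = ±1`, so `stdSymp (chainVec g 3) (shadow b) = ∓1`
  (`stdSymp_int_swap`);
* §6 with `stdSymp (chainVec g i) (shadow b) = 0` for `i ≠ 3` (`helper_eOne_zero_pairings`) and G6's
  algebra `eq_single_one_of_stdSymp_chainVec`: `shadow b = ±e_1`;
* §7 **`helper_exists_eOneCurve`** = (R-E1CURVE): the charted page curve `(eoChart hg, b)` of `page g 1`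
  with shadow `±e_1` — the lift to one sheet of the round loop around `ζ_0, ζ_1, ζ_2, ζ_3`, Humphries'
  curve (not in the orbit of the chain curves under chain twists, G6-0).

Everything is proved; no `sorry`.  References: B. Farb, D. Margalit, *A primer on mapping class
groups* (2012), Prop. 6.3, §6.1 [FarbMargalit2012]; W. Fulton, *Algebraic Topology* (1995), §3
[Fulton1995].
-/

noncomputable section

set_option linter.dupNamespace false

open scoped Manifold ContDiff Topology ComplexConjugate Real
open Set Function Metric Complex
open Literature.Topology.FourManifolds Literature.Topology.FourManifolds.LefschetzBase
  Literature.Topology.FourManifolds.TorusKnotMilnor Literature.GroupTheory.CombinatorialGroupTheory.SignedHurwitz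

namespace Summit.SmoothPoincare4.SmoothPoincare4.Theorems.AcyclicBisectionExists.ModpBraidOrbits

variable {g : ℕ} {u : ℝ}

/-! ## §3 One clean passage -/

variable {M : sphere (0 : EuclideanSpace ℝ (Fin 2)) 1 → Base g}

/-- **The returning radial leg**: on `[1/2, 3/4]` the path is the ray point at radius
`(R − κ) + (3 − 4τ)(‖ζ_4 − c₀‖ − (R − κ))`, decreasing from `‖ζ_4 − c₀‖` to `R − κ`. [folklore] -/
theorem eoPath_ret (hg : 2 ≤ g) {τ : ℝ} (hτ : τ ∈ Icc (1 / 2 : ℝ) (3 / 4)) :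
    eoPath g τ = eoCenter g + (((eoRad g - eoKap g) + (3 - 4 * τ) * (‖branchPt g 4 - eoCenter g‖ - (eoRad g - eoKap g)) : ℝ) : ℂ) * eoDir g ∧
    ‖eoPath g τ - eoCenter g‖ = (eoRad g - eoKap g) + (3 - 4 * τ) * (‖branchPt g 4 - eoCenter g‖ - (eoRad g - eoKap g)) := by
  have e : eoPath g τ = eoCenter g + (((eoRad g - eoKap g) + (3 - 4 * τ) * (‖branchPt g 4 - eoCenter g‖ - (eoRad g - eoKap g)) : ℝ) : ℂ) * eoDir g := by
    rw [← eoPath_one_sub, eoPath_of_mem_rad ⟨by linarith [hτ.2], by linarith [hτ.1]⟩, eoRho]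
    congr 1; push_cast; ring
  refine ⟨e, ?_⟩
  have hD := norm_four_sub_center_gt hg
  have hk := (eoKap_bounds hg).1
  have hA0 : 0 ≤ eoRad g - eoKap g := by have := eoRad_ge g; have := (eoKap_bounds hg).2; linarith
  rw [e, add_sub_cancel_left, norm_mul, norm_eoDir hg, mul_one, Complex.norm_real, Real.norm_eq_abs, abs_of_nonneg]
  nlinarith [hτ.2]

/-- **The out-going radial leg is off the closed collar** (`τ ∈ [1/4, 1/2]`): where its radius is a
collar radius it runs on the sheet `s √`, the other one. [folklore] -/
theorem passage_off_out (hg : 2 ≤ g) (hu : cexp (((2 * π * u : ℝ) : ℂ) * I) = eoDir g) {s : ℂ} (hs0 : s ≠ 0)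
    (hMτ : ∀ τ ∈ Icc (0 : ℝ) 1, (M (circlePt τ)).1 =
      pagePt g 1 (eoPath g τ) (s * halfSign τ * csqrt (eoPath g τ ^ (2 * g + 1) + 1)))
    (hY : ∀ r ∈ Icc (-1 : ℝ) 1, eoY g (eoX g (u, r)) = -s * csqrt (eoX g (u, r) ^ (2 * g + 1) + 1))
    {τ : ℝ} (hτ : τ ∈ Icc (1 / 4 : ℝ) (1 / 2)) :
    M (circlePt τ) ∉ eoChart hg '' (univ ×ˢ Icc (-(1 / 2) : ℝ) (1 / 2)) := by
  have hg1 : 1 ≤ g := by omega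
  have hanti := strictAntiOn_eoRadP hg1
  have hτ01 : τ ∈ Icc (0 : ℝ) 1 := ⟨by linarith [hτ.1], by linarith [hτ.2]⟩
  have hMx : cx (M (circlePt τ)).1 = scaleX g 1 * eoPath g τ := by rw [hMτ τ hτ01, cx_pagePt]
  by_cases hr : ‖eoPath g τ - eoCenter g‖ < eoRadP g (1 / 2) ∨ eoRadP g (-(1 / 2)) < ‖eoPath g τ - eoCenter g‖
  · exact not_mem_collar_of_radius hg hMx hr
  · push Not at hr
    -- the radius is a chart radius `eoRadP r`, `r ∈ [−1, 1]`
    have hρ := eoRho_mem hg hτ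
    have hA0 : 0 ≤ eoRad g - eoKap g := by have := eoRad_ge g; have := (eoKap_bounds hg).2; linarith
    have m1 : (-1 : ℝ) ∈ Icc (-1 : ℝ) 1 := ⟨le_rfl, by norm_num⟩
    have p1 : (1 : ℝ) ∈ Icc (-1 : ℝ) 1 := ⟨by norm_num, le_rfl⟩
    have hmem : ‖eoPath g τ - eoCenter g‖ ∈ Icc (eoRadP g 1) (eoRadP g (-1)) :=
      ⟨by linarith [hr.1, hanti.antitoneOn ⟨by norm_num, by norm_num⟩ p1 (show (1 / 2 : ℝ) ≤ 1 by norm_num)],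
       by linarith [hr.2, hanti.antitoneOn m1 ⟨by norm_num, by norm_num⟩ (show (-1 : ℝ) ≤ -(1 / 2) by norm_num)]⟩
    obtain ⟨r, hr1, hre⟩ := intermediate_value_Icc' (by norm_num) (contDiff_eoRadP g).continuous.continuousOn hmem
    have h1 : ‖eoPath g τ - eoCenter g‖ = eoRho g τ := by
      rw [eoPath_of_mem_rad hτ, add_sub_cancel_left, norm_mul, norm_eoDir hg, mul_one, Complex.norm_real,
        Real.norm_eq_abs, abs_of_nonneg (hA0.trans hρ.1)]
    have hxeq : eoPath g τ = eoX g (u, r) := by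
      rw [eoX_ray hu, eoPath_of_mem_rad hτ, ← h1, hre]
    rintro ⟨p, -, hp⟩
    refine eoChart_ne_of_sheet hg (x' := eoPath g τ) hs0 ?_ ?_ ?_ p hp
    · rw [hxeq]; exact pow_add_one_ne_zero_of_norm_lt (by
        rw [eoX_ray hu]; exact norm_ray_lt_one hg (eoRadP_lt_norm_four hg r).1 (eoRadP_lt_norm_four hg r).2)
    · rw [hMτ τ hτ01, show halfSign τ = 1 from if_pos hτ.2, mul_one]
    · rw [hxeq]; exact hY r hr1

/-- **On the returning leg, at a radius in `[eoRadP (3/4), eoRadP (−3/4)]`, the loop IS a chart point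
`eoChart (u⋆, r)` with `r ∈ [−3/4, 3/4]` and `eoRadP r` that radius.** [folklore] -/
theorem passage_on_ret (hg : 2 ≤ g) (hu : cexp (((2 * π * u : ℝ) : ℂ) * I) = eoDir g) {s : ℂ}
    (hMτ : ∀ τ ∈ Icc (0 : ℝ) 1, (M (circlePt τ)).1 =
      pagePt g 1 (eoPath g τ) (s * halfSign τ * csqrt (eoPath g τ ^ (2 * g + 1) + 1)))
    (hY : ∀ r ∈ Icc (-1 : ℝ) 1, eoY g (eoX g (u, r)) = -s * csqrt (eoX g (u, r) ^ (2 * g + 1) + 1))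
    {τ : ℝ} (hτ : τ ∈ Ioc (1 / 2 : ℝ) (3 / 4))
    (hmem : ‖eoPath g τ - eoCenter g‖ ∈ Icc (eoRadP g (3 / 4)) (eoRadP g (-(3 / 4)))) :
    ∃ r ∈ Icc (-(3 / 4) : ℝ) (3 / 4), eoRadP g r = ‖eoPath g τ - eoCenter g‖ ∧ M (circlePt τ) = eoChart hg (u, r) := by
  have hτ' : τ ∈ Icc (1 / 2 : ℝ) (3 / 4) := ⟨hτ.1.le, hτ.2⟩
  have hτ01 : τ ∈ Icc (0 : ℝ) 1 := ⟨by linarith [hτ.1], by linarith [hτ.2]⟩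
  obtain ⟨r, hr1, hre⟩ := intermediate_value_Icc' (by norm_num) (contDiff_eoRadP g).continuous.continuousOn hmem
  refine ⟨r, hr1, hre, Subtype.ext ?_⟩
  have hr11 : r ∈ Icc (-1 : ℝ) 1 := ⟨by linarith [hr1.1], by linarith [hr1.2]⟩
  obtain ⟨hret, hradius⟩ := eoPath_ret hg hτ'
  have hxeq : eoPath g τ = eoX g (u, r) := by rw [eoX_ray hu, hret, ← hradius, ← hre]
  rw [hMτ τ hτ01, eoChart_val, eoAmb, hY r hr11, ← hxeq, show halfSign τ = -1 from if_neg (not_le.2 hτ.1)]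
  congr 1; ring

/-- **One clean passage**: a page loop `M` of `page g 1` tracing `eoPath g` with
`y = s · halfSign τ · √(x^{2g+1}+1)` (`s = ±1`), whose returning sheet `−s √` is the chart sheet on the
radial segment (`eoY = −s √` there), has `crossingNumber (eoChart hg) M = 1`. [cite: Fulton1995, §3] -/
theorem crossingNumber_eoChart_passage (hg : 2 ≤ g) (hu : cexp (((2 * π * u : ℝ) : ℂ) * I) = eoDir g)
    {s : ℂ} (hs : s = 1 ∨ s = -1) (hM : Continuous M) (hMp : ∀ θ, M θ ∈ page g 1)
    (hMτ : ∀ τ ∈ Icc (0 : ℝ) 1, (M (circlePt τ)).1 =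
      pagePt g 1 (eoPath g τ) (s * halfSign τ * csqrt (eoPath g τ ^ (2 * g + 1) + 1)))
    (hY : ∀ r ∈ Icc (-1 : ℝ) 1, eoY g (eoX g (u, r)) = -s * csqrt (eoX g (u, r) ^ (2 * g + 1) + 1)) :
    crossingNumber (eoChart hg) M = 1 := by
  have hg1 : 1 ≤ g := by omega
  have hs0 : s ≠ 0 := by rcases hs with rfl | rfl <;> norm_num
  have hφ1 := eoChart_periodic hg
  have hφi := eoChart_injOn hg
  have hanti := strictAntiOn_eoRadP hg1
  -- radii: `A = R − κ = eoRadP 1 < ρ_lo = eoRadP (3/4) < ρ_hi = eoRadP (−3/4) < R + κ < D = ‖ζ_4 − c₀‖`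
  obtain ⟨A, hA⟩ : ∃ A : ℝ, A = eoRad g - eoKap g := ⟨_, rfl⟩
  obtain ⟨D, hD⟩ : ∃ D : ℝ, D = ‖branchPt g 4 - eoCenter g‖ := ⟨_, rfl⟩
  have hA1 : eoRadP g 1 = A := by
    rw [hA, eoRadP, show π * 1 / 2 = π / 2 by ring, Real.sin_pi_div_two, mul_one]
  have hDgt : eoRad g + eoKap g < D := by
    have := norm_four_sub_center_gt hg; have := (eoKap_bounds hg).1; rw [hD]; linarith
  have m1 : (-1 : ℝ) ∈ Icc (-1 : ℝ) 1 := ⟨le_rfl, by norm_num⟩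
  have m34 : (-(3 / 4) : ℝ) ∈ Icc (-1 : ℝ) 1 := ⟨by norm_num, by norm_num⟩
  have m12 : (-(1 / 2) : ℝ) ∈ Icc (-1 : ℝ) 1 := ⟨by norm_num, by norm_num⟩
  have p12 : ((1 / 2) : ℝ) ∈ Icc (-1 : ℝ) 1 := ⟨by norm_num, by norm_num⟩
  have p34 : ((3 / 4) : ℝ) ∈ Icc (-1 : ℝ) 1 := ⟨by norm_num, by norm_num⟩
  have p1 : (1 : ℝ) ∈ Icc (-1 : ℝ) 1 := ⟨by norm_num, le_rfl⟩
  have hlo_lt : eoRadP g (3 / 4) < eoRadP g (1 / 2) := hanti p12 p34 (by norm_num)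
  have hhi_gt : eoRadP g (-(1 / 2)) < eoRadP g (-(3 / 4)) := hanti m34 m12 (by norm_num)
  have hA_lt : A < eoRadP g (3 / 4) := by rw [← hA1]; exact hanti p34 p1 (by norm_num)
  have hAm1 : eoRadP g (-1) = eoRad g + eoKap g := by
    rw [eoRadP, show π * (-1) / 2 = -(π / 2) by ring, Real.sin_neg, Real.sin_pi_div_two]; ring
  have hhi_lt : eoRadP g (-(3 / 4)) < eoRad g + eoKap g := by rw [← hAm1]; exact hanti m1 m34 (by norm_num)
  have hlohi : eoRadP g (3 / 4) < eoRadP g (-(3 / 4)) := hanti m34 p34 (by norm_num)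
  have hB : 0 < D - A := by linarith
  -- the passage parameters `s₀ < t₀` in `(1/2, 3/4)`: radius `ρ_hi` at `s₀`, `ρ_lo` at `t₀`
  obtain ⟨s₀, hs₀⟩ : ∃ s₀ : ℝ, s₀ = 3 / 4 - (eoRadP g (-(3 / 4)) - A) / (4 * (D - A)) := ⟨_, rfl⟩
  obtain ⟨t₀, ht₀⟩ : ∃ t₀ : ℝ, t₀ = 3 / 4 - (eoRadP g (3 / 4) - A) / (4 * (D - A)) := ⟨_, rfl⟩
  have hrad_s : A + (3 - 4 * s₀) * (D - A) = eoRadP g (-(3 / 4)) := by rw [hs₀]; field_simp; ring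
  have hrad_t : A + (3 - 4 * t₀) * (D - A) = eoRadP g (3 / 4) := by rw [ht₀]; field_simp; ring
  have hs12 : 1 / 2 < s₀ := by
    have : (eoRadP g (-(3 / 4)) - A) / (4 * (D - A)) < 1 / 4 := by
      rw [div_lt_iff₀ (by positivity)]; linarith
    rw [hs₀]; linarith
  have hst : s₀ < t₀ := by
    have := div_lt_div_of_pos_right (show eoRadP g (3 / 4) - A < eoRadP g (-(3 / 4)) - A by linarith)
      (show (0 : ℝ) < 4 * (D - A) by positivity)
    rw [hs₀, ht₀]; linarith
  have ht34 : t₀ < 3 / 4 := by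
    have : 0 < (eoRadP g (3 / 4) - A) / (4 * (D - A)) := div_pos (by linarith) (by positivity)
    rw [ht₀]; linarith
  -- radius along the returning leg
  have hradius : ∀ τ ∈ Icc (1 / 2 : ℝ) (3 / 4), ‖eoPath g τ - eoCenter g‖ = A + (3 - 4 * τ) * (D - A) := by
    intro τ hτ; rw [(eoPath_ret hg hτ).2, hA, hD]
  -- (E1) off the collar when the radius is off `[eoRadP (1/2), eoRadP (−1/2)]`
  have off_rad : ∀ τ ∈ Icc (0 : ℝ) 1, (‖eoPath g τ - eoCenter g‖ < eoRadP g (1 / 2) ∨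
      eoRadP g (-(1 / 2)) < ‖eoPath g τ - eoCenter g‖) →
      M (circlePt τ) ∉ eoChart hg '' (univ ×ˢ Icc (-(1 / 2) : ℝ) (1 / 2)) := fun τ hτ h =>
    not_mem_collar_of_radius hg (by rw [hMτ τ hτ, cx_pagePt]) h
  -- the segment legs `[0, 1/4]`, `[3/4, 1]` are within `A = eoRadP 1 < eoRadP (1/2)` of the centre
  have off_seg : ∀ τ ∈ Icc (0 : ℝ) 1, (τ ≤ 1 / 4 ∨ 3 / 4 ≤ τ) →
      M (circlePt τ) ∉ eoChart hg '' (univ ×ˢ Icc (-(1 / 2) : ℝ) (1 / 2)) := by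
    intro τ hτ h
    refine off_rad τ hτ (Or.inl (lt_of_le_of_lt ?_ (hA_lt.trans hlo_lt)))
    rw [hA]
    rcases h with h | h
    · exact norm_eoPath_sub_center_le hg hτ.1 h
    · rw [← eoPath_one_sub]; exact norm_eoPath_sub_center_le hg (by linarith [hτ.2]) (by linarith)
  -- on `[s₀, t₀]` the loop IS the chart along the phase `u⋆`, heights in `[−3/4, 3/4]`
  have on_pass : ∀ τ ∈ Icc s₀ t₀, ∃ r ∈ Icc (-(3 / 4) : ℝ) (3 / 4), eoRadP g r = ‖eoPath g τ - eoCenter g‖ ∧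
      M (circlePt τ) = eoChart hg (u, r) := by
    intro τ hτ
    refine passage_on_ret hg hu hMτ hY ⟨by linarith [hτ.1], by linarith [hτ.2]⟩ ?_
    rw [hradius τ ⟨by linarith [hτ.1], by linarith [hτ.2]⟩, ← hrad_s, ← hrad_t]
    constructor <;> nlinarith [hτ.1, hτ.2]
  -- assemble the single passage
  refine crossingNumber_single_passage (by simp) (continuous_eoChart hg) hφ1 (helper_eoChart_mem_page g hg) hφi hM hMp
    (by linarith) hst.le (by linarith) ?_ ?_ ?_ ?_ ?_
  · intro τ hτ
    obtain ⟨r, hr1, -, hM'⟩ := on_pass τ hτ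
    exact ⟨(u, r), ⟨mem_univ _, ⟨by linarith [hr1.1], by linarith [hr1.2]⟩⟩, hM'.symm⟩
  · intro τ hτ
    have hτ01 : τ ∈ Icc (0 : ℝ) 1 := ⟨hτ.1, by linarith [hτ.2, hst, ht34]⟩
    rcases le_or_gt τ (1 / 4) with h4 | h4
    · exact off_seg τ hτ01 (Or.inl h4)
    rcases le_or_gt τ (1 / 2) with h2 | h2
    · exact passage_off_out hg hu hs0 hMτ hY ⟨h4.le, h2⟩
    · refine off_rad τ hτ01 (Or.inr ?_)
      rw [hradius τ ⟨h2.le, hτ.2.trans (hst.le.trans ht34.le)⟩]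
      calc eoRadP g (-(1 / 2)) < eoRadP g (-(3 / 4)) := hhi_gt
        _ = A + (3 - 4 * s₀) * (D - A) := hrad_s.symm
        _ ≤ A + (3 - 4 * τ) * (D - A) := by nlinarith [hτ.2]
  · intro τ hτ
    have hτ01 : τ ∈ Icc (0 : ℝ) 1 := ⟨by linarith [hτ.1, hs12, hst], hτ.2⟩
    rcases le_or_gt (3 / 4) τ with h4 | h4
    · exact off_seg τ hτ01 (Or.inr h4)
    · refine off_rad τ hτ01 (Or.inl ?_)
      rw [hradius τ ⟨(hs12.le.trans hst.le).trans hτ.1, h4.le⟩]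
      calc A + (3 - 4 * τ) * (D - A) ≤ A + (3 - 4 * t₀) * (D - A) := by nlinarith [hτ.1]
        _ = eoRadP g (3 / 4) := hrad_t
        _ < eoRadP g (1 / 2) := hlo_lt
  · obtain ⟨r, hr1, hre, hM'⟩ := on_pass s₀ ⟨le_rfl, hst.le⟩
    rw [hradius s₀ ⟨hs12.le, hst.le.trans ht34.le⟩, hrad_s] at hre
    have : r = -(3 / 4) := hanti.injOn ⟨by linarith [hr1.1], by linarith [hr1.2]⟩ m34 hre
    rw [hM', this, height_of_lift hφ1 hφi (by norm_num)]; norm_num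
  · obtain ⟨r, hr1, hre, hM'⟩ := on_pass t₀ ⟨hst.le, le_rfl⟩
    rw [hradius t₀ ⟨hs12.le.trans hst.le, ht34.le⟩, hrad_t] at hre
    have : r = 3 / 4 := hanti.injOn ⟨by linarith [hr1.1], by linarith [hr1.2]⟩ p34 hre
    rw [hM', this, height_of_lift hφ1 hφi (by norm_num)]; norm_num

/-! ## §4 The registered form -/

/-- **Sub-goal `helper_eOne_passage`** (H5-5 of the `e_1`-curve (R-E1CURVE) for node N3a of NF4): a page
loop `M` of `page g 1` tracing the radial zig-zag `eoPath g` with `y = s · halfSign · √(x^{2g+1}+1)`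
(`s = ±1`), whose returning sheet `−s √` is the sheet `eoY` of the annulus chart `eoChart hg` on its
radial segment of phase `u` (`e^{2πiu} = eoDir g`), crosses that chart exactly once, upwards:
`crossingNumber (eoChart hg) M = 1`. [cite: Fulton1995, §3] -/
theorem helper_eOne_passage : ∀ (g : ℕ) (hg : 2 ≤ g) (u : ℝ), Complex.exp (((2 * Real.pi * u : ℝ) : ℂ) * Complex.I) = Summit.SmoothPoincare4.SmoothPoincare4.Theorems.AcyclicBisectionExists.ModpBraidOrbits.eoDir g → ∀ (s : ℂ), (s = 1 ∨ s = -1) → ∀ (M : Metric.sphere (0 : EuclideanSpace ℝ (Fin 2)) 1 → Literature.Topology.FourManifolds.LefschetzBase.Base g), Continuous M → (∀ θ, M θ ∈ Literature.Topology.FourManifolds.LefschetzBase.page g 1) → (∀ τ ∈ Set.Icc (0 : ℝ) 1, (M (Literature.Topology.FourManifolds.circlePt τ)).1 = Summit.SmoothPoincare4.SmoothPoincare4.Theorems.AcyclicBisectionExists.ModpBraidOrbits.pagePt g 1 (Summit.SmoothPoincare4.SmoothPoincare4.Theorems.AcyclicBisectionExists.ModpBraidOrbits.eoPath g τ) (s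 * Summit.SmoothPoincare4.SmoothPoincare4.Theorems.AcyclicBisectionExists.ModpBraidOrbits.halfSign τ * Literature.Topology.FourManifolds.LefschetzBase.csqrt (Summit.SmoothPoincare4.SmoothPoincare4.Theorems.AcyclicBisectionExists.ModpBraidOrbits.eoPath g τ ^ (2 * g + 1) + 1))) → (∀ r ∈ Set.Icc (-1 : ℝ) 1, Summit.SmoothPoincare4.SmoothPoincare4.Theorems.AcyclicBisectionExists.ModpBraidOrbits.eoY g (Summit.SmoothPoincare4.SmoothPoincare4.Theorems.AcyclicBisectionExists.ModpBraidOrbits.eoX g (u, r)) = -s * Literature.Topology.FourManifolds.LefschetzBase.csqrt (Summit.SmoothPoincare4.SmoothPoincare4.Theorems.AcyclicBisectionExists.ModpBraidOrbits.eoX g (u, r) ^ (2 * g + 1) + 1)) → Summit.SmoothPoincare4.SmoothPoincare4.Theorems.AcyclicBisectionExists.ModpBraidOrbits.crossingNumber (Summit.SmoothPoincare4.SmoothPoincare4.Theorems.AcyclicBisectionExists.ModpBraidOrbits.eoChart hg) M = 1 :=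
  fun _ hg _ hu _ hs _ hM hMp hMτ hY => crossingNumber_eoChart_passage hg hu hs hM hMp hMτ hY

/-! ## §5 The crossing number of the chart with the radial vanishing cycle is `±1` -/

/-- **`crossingNumber (eoChart hg) L = ±1`** for the sheet loop `L` over `eoPath g`: if the chart sheet
on the radial segment is the lower one, `L` itself returns on it (`+1`); if it is the upper one, the
reversed loop `L ∘ reflS` does (`+1`), so `L` gives `−1`. [cite: FarbMargalit2012, §6.1] -/
theorem crossingNumber_eoChart_sheetLoop (hg : 2 ≤ g) {L : sphere (0 : EuclideanSpace ℝ (Fin 2)) 1 → Base g}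
    (hL : Continuous L) (hLp : ∀ θ, L θ ∈ page g 1)
    (hLτ : ∀ τ ∈ Icc (0 : ℝ) 1, (L (circlePt τ)).1 = sheetAmb g 1 τ (eoPath g τ)) :
    crossingNumber (eoChart hg) L = 1 ∨ crossingNumber (eoChart hg) L = -1 := by
  obtain ⟨u, hu⟩ := exists_phase_eoDir hg
  obtain ⟨σ, hσ, hY⟩ := exists_sign_radial hg hu
  rcases hσ with rfl | rfl
  · -- chart sheet `+√` on the radial segment: the reversed loop returns on it
    right
    obtain ⟨hRt, hRτ⟩ := reverse_sheetLoop hg hLτ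
    have hR : Continuous (L ∘ reflS) := hL.comp continuous_reflS
    have hRp : ∀ θ, (L ∘ reflS) θ ∈ page g 1 := fun θ => hLp _
    have h1 : crossingNumber (eoChart hg) (L ∘ reflS) = 1 :=
      crossingNumber_eoChart_passage hg hu (s := -1) (Or.inr rfl) hR hRp
        (fun τ hτ => by rw [hRτ τ hτ, neg_one_mul]) (fun r hr => by rw [hY r hr]; ring)
    have hrev := crossingNumber_eq_neg_of_reverse (by simp) (continuous_eoChart hg) (eoChart_periodic hg)
      (helper_eoChart_mem_page g hg) (eoChart_injOn hg) hL hLp hR hRp hRt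
    omega
  · -- chart sheet `−√`: the loop itself returns on it
    left
    exact crossingNumber_eoChart_passage hg hu (s := 1) (Or.inl rfl) hL hLp
      (fun τ hτ => by rw [hLτ τ hτ, sheetAmb, one_mul]) (fun r hr => by rw [hY r hr])

/-- **`stdSymp (chainVec g 3) (shadow b) = ±1`** for the core `b` of `eoChart hg`. [cite: FarbMargalit2012, Prop. 6.3] -/
theorem stdSymp_chainVec_three_shadow_eoCore (hg : 2 ≤ g) {b : sphere (0 : EuclideanSpace ℝ (Fin 2)) 1 → Base g}
    (hb : Continuous b) (hbu : ∀ u, eoChart hg (u, 0) = b (circlePt u)) :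
    stdSymp ℤ g (chainVec g 3) (shadow g b hb) = 1 ∨ stdSymp ℤ g (chainVec g 3) (shadow g b hb) = -1 := by
  obtain ⟨L, hL, hLp, hLτ, hLsh⟩ := helper_eOne_sheetLoop g hg
  have hcn := crossingNumber_eq_stdSymp (c := 1) (by simp) hb (contMDiff_eoChart hg) (eoChart_periodic hg) hbu
    (helper_eoChart_mem_page g hg) (eoChart_injOn hg) (orient_eoChart hg) hL hLp
  rw [hLsh] at hcn
  rw [stdSymp_int_swap, ← hcn]
  rcases crossingNumber_eoChart_sheetLoop hg hL hLp hLτ with h | h <;> omega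

/-! ## §6 The shadow of the `e_1`-curve -/

/-- **The core of `eoChart` has shadow `±e_1`.** [cite: FarbMargalit2012, Prop. 6.3] -/
theorem shadow_eoCore (hg : 2 ≤ g) {b : sphere (0 : EuclideanSpace ℝ (Fin 2)) 1 → Base g}
    (hb : Continuous b) (hbu : ∀ u, eoChart hg (u, 0) = b (circlePt u)) :
    shadow g b hb = Pi.single (Sum.inl (⟨1, hg⟩ : Fin g)) 1 ∨ shadow g b hb = -Pi.single (Sum.inl (⟨1, hg⟩ : Fin g)) 1 := by
  have hbp : ∀ θ, b θ ∈ page g 1 := core_mem_page hbu (helper_eoChart_mem_page g hg)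
  have hbx : ∀ τ : ℝ, cx (b (circlePt τ)).1 =
      scaleX g 1 * (eoCenter g + eoRad g * cexp (((2 * π * τ : ℝ) : ℂ) * I)) := fun τ => by
    rw [← hbu τ, eoChart_val, eoAmb, cx_pagePt, eoX, eoRadP_zero]
  have h0 := helper_eOne_zero_pairings g hg b hb hbp hbx
  have key : ∀ σ : ℤ, stdSymp ℤ g (chainVec g 3) (shadow g b hb) = σ →
      shadow g b hb = (-σ) • Pi.single (Sum.inl (⟨1, hg⟩ : Fin g)) 1 := fun σ h3 =>
    eq_single_one_of_stdSymp_chainVec hg _ σ fun i hi => by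
      by_cases hi3 : i = 3
      · subst hi3; rw [if_pos rfl]; exact h3
      · rw [if_neg hi3]; exact h0 i hi hi3
  rcases stdSymp_chainVec_three_shadow_eoCore hg hb hbu with h3 | h3
  · right; rw [key 1 h3, neg_one_zsmul]
  · left; rw [key (-1) h3, neg_neg, one_zsmul]

/-! ## §7 (R-E1CURVE) -/

/-- **Sub-goal `helper_exists_eOneCurve`** = (R-E1CURVE), the last geometric input of node N3a
`node_STcurve` of NF4 (the hypothesis of G6's `helper_node_STcurve_of_eOneCurve`, verbatim): for every
`g ≥ 2` there is a charted page curve `(φ, b)` of the page `page g 1` — `φ` smooth into the base,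
`1`-periodic, cored by the continuous circle map `b`, with values in `page g 1`, injective on
`[0,1) × (−1,1)`, positively oriented — whose homology shadow is `e_1` or `−e_1`
(`e_1 = Pi.single (Sum.inl 1) 1`).  It is the lift to one sheet of the round loop of the `x`-plane
around the four branch points `ζ_0, ζ_1, ζ_2, ζ_3` — Humphries' curve, NOT in the orbit of the chain
curves under chain twists. [cite: FarbMargalit2012, Prop. 6.3] -/
theorem helper_exists_eOneCurve : ∀ (g : ℕ) (hg : 2 ≤ g), ∃ (φ : ℝ × ℝ → Literature.Topology.FourManifolds.LefschetzBase.Base g) (b : Metric.sphere (0 : EuclideanSpace ℝ (Fin 2)) 1 → Literature.Topology.FourManifolds.LefschetzBase.Base g) (hb : Continuous b), ContMDiff 𝓘(ℝ, ℝ × ℝ) (𝓡∂ 4) ∞ φ ∧ (∀ u r, φ (u + 1, r) = φ (u, r)) ∧ (∀ u, φ (u, 0) = b (Literature.Topology.FourManifolds.circlePt u)) ∧ (∀ p, φ p ∈ Literature.Topology.FourManifolds.LefschetzBase.page g 1) ∧ Set.InjOn φ (Set.Ico (0 : ℝ) 1 ×ˢ Set.Ioo (-1 : ℝ) 1) ∧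 (∀ u r, r ∈ Set.Ioo (-1 : ℝ) 1 → 0 < inner ℝ (deriv (fun r' => (φ (u, r')).1) r) (Literature.Topology.FourManifolds.LefschetzBase.cplxJ (deriv (fun u' => (φ (u', r)).1) u))) ∧ (Literature.Topology.FourManifolds.LefschetzBase.shadow g b hb = Pi.single (Sum.inl (⟨1, hg⟩ : Fin g)) 1 ∨ Literature.Topology.FourManifolds.LefschetzBase.shadow g b hb = -Pi.single (Sum.inl (⟨1, hg⟩ : Fin g)) 1) := by
  intro g hg
  obtain ⟨b, hb, hbu⟩ := exists_eoCore hg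
  exact ⟨eoChart hg, b, hb, contMDiff_eoChart hg, eoChart_periodic hg, hbu, helper_eoChart_mem_page g hg,
    eoChart_injOn hg, orient_eoChart hg, shadow_eoCore hg hb hbu⟩

/-- (R-E1CURVE) in the hypothesis form of `helper_node_STcurve_of_eOneCurve` (`∀ hg : 2 ≤ g, ∃ …`). [folklore] -/
theorem exists_eOneCurve (g : ℕ) : ∀ hg : 2 ≤ g, ∃ (φ : ℝ × ℝ → Base g)
    (b : Metric.sphere (0 : EuclideanSpace ℝ (Fin 2)) 1 → Base g) (hb : Continuous b),
    ContMDiff 𝓘(ℝ, ℝ × ℝ) (𝓡∂ 4) ∞ φ ∧ (∀ u r, φ (u + 1, r) = φ (u, r)) ∧ (∀ u, φ (u, 0) = b (circlePt u)) ∧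
    (∀ p, φ p ∈ page g 1) ∧ InjOn φ (Ico (0 : ℝ) 1 ×ˢ Ioo (-1 : ℝ) 1) ∧
    (∀ u r, r ∈ Ioo (-1 : ℝ) 1 →
      0 < inner ℝ (deriv (fun r' => (φ (u, r')).1) r) (cplxJ (deriv (fun u' => (φ (u', r)).1) u))) ∧
    (shadow g b hb = Pi.single (Sum.inl (⟨1, hg⟩ : Fin g)) 1 ∨ shadow g b hb = -Pi.single (Sum.inl (⟨1, hg⟩ : Fin g)) 1) :=
  fun hg => helper_exists_eOneCurve g hg

end Summit.SmoothPoincare4.SmoothPoincare4.Theorems.AcyclicBisectionExists.ModpBraidOrbits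

end
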